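import Mathlib
import HarnessLib
import Summits.ResolutionOfSingularities.ResolutionOfSingularities.Theorems.WildQuotientsWildQuotientResolutionConductorOneLaw
import Summits.ResolutionOfSingularities.ResolutionOfSingularities.Theorems.WildQuotientsWildQuotientResolutionConductorOneFramePieces

/-!
# S2 brick F3c-2a — the FRAME of the conductor-𝟙 core: the invariant radicands `N(uᵢ) = Tᵢ`,
# `N(uᵢ − u_l) = (uᵢ − u_l)^p / ((1 − uᵢ^{p−1})(1 − u_l^{p−1}))` and the radicand `W_I` of the piece `O_I`

(crux stmt-ResolutionOfSingularities-15640 `WildQuotients.WildQuotientResolution`, line `Sketch`; chain w45c post-V5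
programme S2, design `L/res-L1-w45c-lead-1/S2-DESIGN.md` §1 («charts V[uᵢ] and pieces via INVARIANT radicands
(Tᵢ = uᵢ^p/(1−uᵢ^{p−1}), norms of uᵢ−u_j)») / §6 brick F3; res-L1-w45c-plan-1 NO OBJECTION 2026-08-27T18:26:16Z («seam
via the INVARIANT norm (same D₊) + V5 cover engine»). [OURS · L1 W4.5c] — NOT a statement of any manuscript; replaces
the role of no printed item; AI-produced, weaker than expert review. Def-free (F1's `coreT`). Prover res-D-pv-033.)

`R = CoreRing k p n`, `σ` with the law `σ uᵢ·(1+uᵢ) = uᵢ`, `w_l := (1 − u_l^{p−1})⁻¹` (F1 `isUnit_coreFactor`),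
`Tᵢ = coreT i = uᵢ^p w_i` (F1), `N_{il} := (uᵢ − u_l)^p · (wᵢ w_l)` — the NORMS `∏_{j<p} σʲ(uᵢ)`, `∏_{j<p} σʲ(uᵢ−u_l)`
(`σʲu = u/(1+ju)`, `∏ⱼ(1+ju) = 1−u^{p−1}`; we never expand the products, invariance is proved from the law):
* `sigma_coreFactor_mul` — `σ(1 − u^{p−1})·(1+u)^p = 1 − u^{p−1}` (L1 `core_norm_invariant`); `sigma_coreFactorInv_mul`;
* `sigma_normDiff` — `σ N_{il} = N_{il}`; with F1b `map_coreT_of_law` (`σ Tᵢ = Tᵢ`):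
* **`sigma_pieceRadicand` / `smul_pieceRadicand`** — the radicand
  `W_{i,I} := Tᵢ · ∏_{l ∈ I∖i} T_l · ∏_{l ∉ I} N_{il}` is fixed by `σ`, hence by every `γ ∈ ⟨σ⟩`;
* `pieceRadicand_mem_pow` — `W_{i,I} ∈ 𝔪^{p·(1 + |I∖i| + |Iᶜ|)}`.
-/

-- single-problem summit: the doubled namespace component `ResolutionOfSingularities` is forced
set_option linter.dupNamespace false

noncomputable section

open MvPolynomial
open scoped Pointwise

namespace Summit.ResolutionOfSingularities.ResolutionOfSingularities.Theorems.WildQuotientResolution.ConductorOne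

variable (k : Type) [Field k] (p n : ℕ) [Fact p.Prime] [CharP k p]
  (σ : CoreRing k p n ≃ₐ[k] CoreRing k p n)
  (hσ : ∀ i, σ (coreU k p n i) * (1 + coreU k p n i) = coreU k p n i)

/-- the inverse `w_l = (1 − u_l^{p−1})⁻¹` in `Aₙ` -/
local notation3 (prettyPrint := false) "cw" l => (((isUnit_coreFactor k p n l).unit⁻¹ : (CoreRing k p n)ˣ) :
  CoreRing k p n)
/-- the norm radicand `N_{il} = (uᵢ − u_l)^p · wᵢ w_l` -/
local notation3 (prettyPrint := false) "nD" i:max l:max =>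
  ((coreU k p n i - coreU k p n l) ^ p * ((cw i) * (cw l)))
/-- the piece radicand `W_{i,I} = Tᵢ · ∏_{l ∈ I∖i} T_l · ∏_{l ∉ I} N_{il}` -/
local notation3 (prettyPrint := false) "pieceRad" i:max I:max =>
  (coreT k p n i * (∏ l ∈ Finset.erase I i, coreT k p n l) * (∏ l ∈ Finset.univ \ I, (nD i l)))

/-! ## `σ` on the unit factors -/

omit [Fact p.Prime] [CharP k p] in
/-- `w_l · (1 − u_l^{p−1}) = 1`. [OURS · L1 W4.5c] -/
theorem coreFactorInv_mul (l : Fin n) : (cw l) * (1 - coreU k p n l ^ (p - 1)) = 1 := by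
  have h := (isUnit_coreFactor k p n l).unit.inv_mul
  rwa [IsUnit.unit_spec] at h

include hσ in
/-- `σ(1 − u^{p−1}) · (1+u)^p = 1 − u^{p−1}`. [OURS · L1 W4.5c] -/
theorem sigma_coreFactor_mul (l : Fin n) :
    σ (1 - coreU k p n l ^ (p - 1)) * (1 + coreU k p n l) ^ p = 1 - coreU k p n l ^ (p - 1) := by
  have hp0 : p ≠ 0 := (Fact.out : p.Prime).ne_zero
  have hL1 := core_norm_invariant k p n l
  have hlaw := hσ l
  -- `σ(1 − u^{p−1})·(1+u)^{p-1} = (1+u)^{p−1} − u^{p−1}` since `σu·(1+u) = u`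
  have h1 : σ (1 - coreU k p n l ^ (p - 1)) * (1 + coreU k p n l) ^ (p - 1) =
      (1 + coreU k p n l) ^ (p - 1) - coreU k p n l ^ (p - 1) := by
    rw [map_sub, map_one, map_pow, sub_mul, one_mul, ← mul_pow, hlaw]
  rw [← pow_sub_one_mul hp0 (1 + coreU k p n l), ← mul_assoc, h1]
  exact hL1

omit [CharP k p] in
include hσ in
/-- `σ(w_l) · (1 − u_l^{p−1}) = (1 + u_l)^p`. [OURS · L1 W4.5c] -/
theorem sigma_coreFactorInv_mul [CharP k p] (l : Fin n) :
    σ (cw l) * (1 - coreU k p n l ^ (p - 1)) = (1 + coreU k p n l) ^ p := by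
  have h1 : σ (cw l) * σ (1 - coreU k p n l ^ (p - 1)) = 1 := by
    rw [← map_mul, coreFactorInv_mul, map_one]
  have h2 := sigma_coreFactor_mul k p n σ hσ l
  -- `σ w · (1 − u^{p−1}) = σ w · σ(1−u^{p−1}) · (1+u)^p = (1+u)^p`
  calc σ (cw l) * (1 - coreU k p n l ^ (p - 1))
      = σ (cw l) * (σ (1 - coreU k p n l ^ (p - 1)) * (1 + coreU k p n l) ^ p) := by rw [h2]
    _ = (σ (cw l) * σ (1 - coreU k p n l ^ (p - 1))) * (1 + coreU k p n l) ^ p := by ring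
    _ = (1 + coreU k p n l) ^ p := by rw [h1, one_mul]

/-! ## The norm radicands are invariant -/

include hσ in
/-- **`σ N_{il} = N_{il}`** for `N_{il} = (uᵢ − u_l)^p wᵢ w_l`. [OURS · L1 W4.5c] -/
theorem sigma_normDiff (i l : Fin n) : σ (nD i l) = (nD i l) := by
  have hd : σ (coreU k p n i - coreU k p n l) * ((1 + coreU k p n i) * (1 + coreU k p n l)) =
      coreU k p n i - coreU k p n l := by
    rw [map_sub]; linear_combination (1 + coreU k p n l) * hσ i - (1 + coreU k p n i) * hσ l
  have hi := sigma_coreFactorInv_mul k p n σ hσ i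
  have hl := sigma_coreFactorInv_mul k p n σ hσ l
  have wi := coreFactorInv_mul k p n i
  have wl := coreFactorInv_mul k p n l
  -- cancel the unit `(1 − uᵢ^{p−1})(1 − u_l^{p−1})`
  have hunit : IsUnit ((1 - coreU k p n i ^ (p - 1)) * (1 - coreU k p n l ^ (p - 1))) :=
    (isUnit_coreFactor k p n i).mul (isUnit_coreFactor k p n l)
  refine hunit.mul_right_cancel ?_
  have hdp : σ (coreU k p n i - coreU k p n l) ^ p * ((1 + coreU k p n i) ^ p * (1 + coreU k p n l) ^ p) =
      (coreU k p n i - coreU k p n l) ^ p := by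
    rw [← mul_pow, ← mul_pow, hd]
  have key : σ (nD i l) * ((1 - coreU k p n i ^ (p - 1)) * (1 - coreU k p n l ^ (p - 1))) =
      σ (coreU k p n i - coreU k p n l) ^ p * ((1 + coreU k p n i) ^ p * (1 + coreU k p n l) ^ p) := by
    rw [map_mul, map_mul, map_pow]
    calc σ (coreU k p n i - coreU k p n l) ^ p * (σ (cw i) * σ (cw l)) *
          ((1 - coreU k p n i ^ (p - 1)) * (1 - coreU k p n l ^ (p - 1)))
        = σ (coreU k p n i - coreU k p n l) ^ p * ((σ (cw i) * (1 - coreU k p n i ^ (p - 1))) *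
            (σ (cw l) * (1 - coreU k p n l ^ (p - 1)))) := by ring
      _ = _ := by rw [hi, hl]
  rw [key, hdp]
  calc (coreU k p n i - coreU k p n l) ^ p
      = (coreU k p n i - coreU k p n l) ^ p * (((cw i) * (1 - coreU k p n i ^ (p - 1))) *
          ((cw l) * (1 - coreU k p n l ^ (p - 1)))) := by rw [wi, wl, mul_one, mul_one]
    _ = _ := by ring

include hσ in
/-- **The piece radicand is `σ`-invariant.** [OURS · L1 W4.5c] -/
theorem sigma_pieceRadicand (i : Fin n) (I : Finset (Fin n)) : σ (pieceRad i I) = (pieceRad i I) := by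
  rw [map_mul, map_mul, map_prod, map_prod, map_coreT_of_law k p n σ hσ i]
  congr 1
  · congr 1
    exact Finset.prod_congr rfl fun l _ => map_coreT_of_law k p n σ hσ l
  · exact Finset.prod_congr rfl fun l _ => sigma_normDiff k p n σ hσ i l

include hσ in
/-- Every `γ ∈ ⟨σ⟩` fixes the piece radicand. [OURS · L1 W4.5c] -/
theorem smul_pieceRadicand (γ : Subgroup.zpowers σ) (i : Fin n) (I : Finset (Fin n)) :
    γ • (pieceRad i I) = (pieceRad i I) := by
  obtain ⟨z, hz⟩ := Subgroup.mem_zpowers_iff.mp γ.2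
  change (γ : CoreRing k p n ≃ₐ[k] CoreRing k p n) • (pieceRad i I) = _
  rw [← hz]
  exact MulAction.fixedBy_subset_fixedBy_zpow (CoreRing k p n) σ z (sigma_pieceRadicand k p n σ hσ i I)

/-! ## The radicand lies in the right power of `𝔪` -/

omit [Fact p.Prime] [CharP k p] in
/-- `T_l ∈ 𝔪^p`. [OURS · L1 W4.5c] -/
theorem coreT_mem_pow (l : Fin n) : coreT k p n l ∈ Ideal.span (Set.range (coreU k p n)) ^ p := by
  unfold coreT
  exact Ideal.mul_mem_right _ _ (Ideal.pow_mem_pow (Ideal.mem_span_range_self (f := coreU k p n) (x := l)) p)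

omit [Fact p.Prime] [CharP k p] in
/-- `N_{il} ∈ 𝔪^p`. [OURS · L1 W4.5c] -/
theorem normDiff_mem_pow (i l : Fin n) : (nD i l) ∈ Ideal.span (Set.range (coreU k p n)) ^ p :=
  Ideal.mul_mem_right _ _ (Ideal.pow_mem_pow
    (Ideal.sub_mem _ (Ideal.mem_span_range_self (f := coreU k p n) (x := i))
      (Ideal.mem_span_range_self (f := coreU k p n) (x := l))) p)

omit [Fact p.Prime] [CharP k p] in
/-- **`W_{i,I} ∈ 𝔪^{p·(1 + |I∖i| + |Iᶜ|)}`.** [OURS · L1 W4.5c] -/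
theorem pieceRadicand_mem_pow (i : Fin n) (I : Finset (Fin n)) :
    (pieceRad i I) ∈ Ideal.span (Set.range (coreU k p n)) ^
      (p + (I.erase i).card * p + (Finset.univ \ I).card * p) := by
  rw [pow_add, pow_add]
  refine Ideal.mul_mem_mul (Ideal.mul_mem_mul (coreT_mem_pow k p n i) ?_) ?_
  · rw [pow_mul', ← Finset.prod_const]
    exact Ideal.prod_mem_prod fun l _ => coreT_mem_pow k p n l
  · rw [pow_mul', ← Finset.prod_const]
    exact Ideal.prod_mem_prod fun l _ => normDiff_mem_pow k p n i l

end Summit.ResolutionOfSingularities.ResolutionOfSingularities.Theorems.WildQuotientResolution.ConductorOne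

end
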